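import Mathlib
import Summits.ResolutionOfSingularities.ResolutionOfSingularities.Theorems.WeightedInvariantLocalWeightedDropWildMonicFlagNnDefs

/-!
# `WeightedInvariant.LocalWeightedDrop`, line `hasse-ridge-face-selection`, S3ρ sub-stub S3ρD `stub_wildMonicSurfaceDescent`:
# LARGE TANGENCY — for `n` beyond a bound read off the point set, the `(1,n)`-initial line is ONE point and `d_{𝓕,x} = epsL`

Crux item stmt-ResolutionOfSingularities-8899 `LocalWeightedDrop` (route `ResolutionOfSingularities/WeightedInvariant`), engine of the
door `HypersurfaceCentreConstruction` stmt-ResolutionOfSingularities-19897.  [OURS · L1 W4.3, chain w43, res-L1-w43-stub-5 = seat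
res-D-pv-056, third seat on S3ρ under res-type-083; point-set input to D-0 (Per17 Prop. 7.4.8 «`∃ N: n_𝓕 ≥ N ⇒ d_𝓕 = −1`» /
Lemma 6.2.5 «`in_{ω_n}(J₂) = (x^r y^s)` for `n ≥ N`» / Hauser–Perlega 2024 Prop. 3 «there exists `N` such that `in_{ω_n}(F)` is, up to a
constant, a monomial for all `n ≥ N`»), on the numbers of `…WildMonicFlagNnDefs`.  Nothing here is a statement of H. Hironaka's manuscript;
OUR lemmas about OUR point-set numbers.]

For a FIXED point set `N ⊂ ℕ²` (the scaled Newton set in given coordinates) let `ε = epsL N` (least height) and `a⋆ = ` the least `P₀`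
among the points of height `ε`.  Then for every `n > a⋆`: the `(1,n)`-weighted order is `a⋆ + n·ε`, the `(1,n)`-initial line is the
single point `(a⋆, ε)`, and `initHeight n N = ε`.  (Per17's Prop. 7.4.8 combines this with the cleanness of tangent flags — Lemma 6.2.5 —
to bound `n_𝓕` when `d_𝓕 > 0`; that combination is D-0 and not here.)

* `exists_lowCorner` — the point `(a⋆, ε) ∈ N` with `ε = epsL N`, `a⋆` least among height-`ε` points;
* `wOrdN_eq_of_lt` — `n > a⋆ ⇒ wOrdN n N = a⋆ + n·ε`;
* `initial_iff_of_lt` — `n > a⋆ ⇒ (P on the (1,n)-initial line ↔ P = (a⋆, ε))` for `P ∈ N`;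
* `initHeight_eq_epsL_of_lt` — `n > a⋆ ⇒ initHeight n N = epsL N`; `dFlagN_eq_of_lt` reads `d_𝓕` off `ε` accordingly.
AI-written; gate-accepted means sorry-free with standard axioms, not refereed.
-/

set_option linter.dupNamespace false -- mandated namespace of this single-conjunct summit

namespace Summit.ResolutionOfSingularities.ResolutionOfSingularities.Theorems

namespace WildMonic

open MonicDescent

variable {N : Set (Fin 2 →₀ ℕ)}

/-- THE LOW CORNER of a nonempty point set: a point of least height `ε = epsL N` whose first coordinate `a⋆` is least among the points of
that height. -/
theorem exists_lowCorner (hN : N.Nonempty) :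
    ∃ P ∈ N, P 1 = epsL N ∧ ∀ Q ∈ N, Q 1 = epsL N → P 0 ≤ Q 0 := by
  classical
  have hS : ((fun P : Fin 2 →₀ ℕ => P 0) '' {P | P ∈ N ∧ P 1 = epsL N}).Nonempty := by
    obtain ⟨P, hP, hPe⟩ := exists_eq_epsL hN
    exact ⟨P 0, P, ⟨hP, hPe⟩, rfl⟩
  obtain ⟨P, ⟨hP, hPe⟩, hP0⟩ := Nat.sInf_mem hS
  have hP0' : P 0 = sInf ((fun P : Fin 2 →₀ ℕ => P 0) '' {P | P ∈ N ∧ P 1 = epsL N}) := hP0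
  refine ⟨P, hP, hPe, fun Q hQ hQe => ?_⟩
  rw [hP0']
  exact Nat.sInf_le ⟨Q, ⟨hQ, hQe⟩, rfl⟩

/-- For `n > a⋆` every point other than the low corner has STRICTLY larger `(1,n)`-weight than the low corner. -/
theorem lowCorner_weight_lt {P : Fin 2 →₀ ℕ} (hPe : P 1 = epsL N) (hPmin : ∀ Q ∈ N, Q 1 = epsL N → P 0 ≤ Q 0)
    {n : ℕ} (hn : P 0 < n) {Q : Fin 2 →₀ ℕ} (hQ : Q ∈ N) (hne : Q ≠ P) : P 0 + n * P 1 < Q 0 + n * Q 1 := by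
  have hQe : epsL N ≤ Q 1 := epsL_le hQ
  rcases Nat.lt_or_ge (epsL N) (Q 1) with hlt | hge
  · -- higher row: `Q₀ + n Q₁ ≥ n (ε + 1) > a⋆ + n ε`
    have : n * (epsL N + 1) ≤ n * Q 1 := Nat.mul_le_mul_left n hlt
    nlinarith
  · -- same row: `Q₁ = ε`, then `Q₀ > a⋆` (else `Q = P`)
    have hQe' : Q 1 = epsL N := le_antisymm hge hQe
    have h0 := hPmin Q hQ hQe'
    have hne0 : Q 0 ≠ P 0 := by
      intro h
      apply hne
      ext i
      fin_cases i
      · exact h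
      · exact hQe'.trans hPe.symm
    have : P 0 < Q 0 := lt_of_le_of_ne h0 (Ne.symm hne0)
    rw [hPe, hQe']
    omega

/-- LARGE TANGENCY, THE WEIGHTED ORDER: for `n > a⋆`, `wOrdN n N = a⋆ + n·ε` (the low corner carries the `(1,n)`-order). -/
theorem wOrdN_eq_of_lt {P : Fin 2 →₀ ℕ} (hP : P ∈ N) (hPe : P 1 = epsL N) (hPmin : ∀ Q ∈ N, Q 1 = epsL N → P 0 ≤ Q 0)
    {n : ℕ} (hn : P 0 < n) : wOrdN n N = P 0 + n * P 1 := by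
  apply le_antisymm (wOrdN_le n hP)
  obtain ⟨Q, hQ, hQw⟩ := exists_eq_wOrdN n ⟨P, hP⟩
  rw [← hQw]
  by_cases hQP : Q = P
  · rw [hQP]
  · exact (lowCorner_weight_lt hPe hPmin hn hQ hQP).le

/-- LARGE TANGENCY, THE INITIAL LINE IS ONE POINT: for `n > a⋆`, a point of `N` lies on the `(1,n)`-initial line iff it is the low corner
(Per17 Lemma 6.2.5 / HP Prop. 3: «`in_{ω_n}` is a monomial for `n ≥ N`», on point sets). -/
theorem initial_iff_of_lt {P : Fin 2 →₀ ℕ} (hP : P ∈ N) (hPe : P 1 = epsL N) (hPmin : ∀ Q ∈ N, Q 1 = epsL N → P 0 ≤ Q 0)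
    {n : ℕ} (hn : P 0 < n) {Q : Fin 2 →₀ ℕ} (hQ : Q ∈ N) : Q 0 + n * Q 1 = wOrdN n N ↔ Q = P := by
  rw [wOrdN_eq_of_lt hP hPe hPmin hn]
  constructor
  · intro h
    by_contra hne
    exact absurd h (lowCorner_weight_lt hPe hPmin hn hQ hne).ne'
  · rintro rfl; rfl

/-- LARGE TANGENCY, `d_{𝓕,x} = ε`: for `n > a⋆`, `initHeight n N = epsL N`. -/
theorem initHeight_eq_epsL_of_lt {P : Fin 2 →₀ ℕ} (hP : P ∈ N) (hPe : P 1 = epsL N)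
    (hPmin : ∀ Q ∈ N, Q 1 = epsL N → P 0 ≤ Q 0) {n : ℕ} (hn : P 0 < n) : initHeight n N = epsL N := by
  have hPw : P 0 + n * P 1 = wOrdN n N := (initial_iff_of_lt hP hPe hPmin hn hP).mpr rfl
  apply le_antisymm
  · rw [← hPe]; exact initHeight_le n hP hPw
  · obtain ⟨Q, hQ, hQw, hQh⟩ := exists_eq_initHeight n ⟨P, hP⟩
    have hQP : Q = P := (initial_iff_of_lt hP hPe hPmin hn hQ).mp hQw
    rw [← hQh, hQP, hPe]

/-- Consequently `d_𝓕` for large tangency is read off `ε` alone: `dFlagN L n N = ε` if `ε ≥ L`, and in the small range it is `ε` or `0` by the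
divisibility convention on `m_𝓕 = max(a⋆ + nε, nL)`.  In particular `ε = 0` (a point of `N` ON the flag axis) gives `d_𝓕 = 0` — the HP/Per17
«`d_𝓕 = −1` for `n ≥ N`» when the tuple is clean (D-0 supplies cleanness; here only the point-set reading). -/
theorem dFlagN_eq_zero_of_lt_of_epsL_eq_zero {L : ℕ} (hL : 0 < L) {P : Fin 2 →₀ ℕ} (hP : P ∈ N) (hPe : P 1 = epsL N)
    (hPmin : ∀ Q ∈ N, Q 1 = epsL N → P 0 ≤ Q 0) {n : ℕ} (hn : P 0 < n) (hε : epsL N = 0) : dFlagN L n N = 0 :=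
  dFlagN_of_eq_zero hL (by rw [initHeight_eq_epsL_of_lt hP hPe hPmin hn, hε])

end WildMonic

end Summit.ResolutionOfSingularities.ResolutionOfSingularities.Theorems
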